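import Literature.NumberTheory.LFunctions.PoissonTwistedProgression
import Literature.NumberTheory.Sieve.RamanujanSum
import HarnessLib

/-!
# Completion of sums with smooth weights (Polymath 8a, Lemma 4.9)

Topic `Literature/NumberTheory/Sieve`, grouping namespace `Polymath8a`; a support file for the named
fact `Literature.NumberTheory.Sieve.mpz_of_lt` (**parity.S29**, `ParityWave0.lean`).  Source:
D. H. J. Polymath, *New equidistribution estimates of Zhang type*, Algebra & Number Theory 8:9 (2014)
2067–2199 = arXiv:1402.0811, §4.4 "Incomplete exponential sums", **Lemma 4.9 (Completion of
sums)** — the Pólya–Vinogradov completion technique for sums `∑_m ψ_M(m) f(m)` of a `q`-periodic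
`f` against a smooth weight `ψ_M(x) = ψ((x − x₀)/M)`, which is the first tool of every Type I/II/III
estimate of the paper (Proposition 4.12, Corollary 4.16, §5.3 (dispersion), §7.2, §8.2).  As printed:

"(i) If `f : ℤ/qℤ → ℂ` is a function, then
`|∑_m ψ_M(m) f(m) − (M'/q) ∑_{m ∈ ℤ/qℤ} f(m)| ≪ q^{1/2} (log M)^{O(1)} sup_{h ∈ ℤ/qℤ∖{0}} |FT_q(f)(h)|`
… We also have the variant
`|∑_m ψ_M(m) f(m) − (M'/q) ∑_{m ∈ ℤ/qℤ} f(m)| ≪ (log M)^{O(1)} (M/q^{1/2}) ∑_{0<|h|≤qM^{−1+ε}} |FT_q(f)(h)| + M^{−A} ∑_{m ∈ ℤ/qℤ} |f(m)|`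
for any fixed `A > 0` and `ε > 0` … (ii) If `I` is a finite index set, and for each `i ∈ I`, `c_i` is
a complex number and `a_i (q)` is a residue class, then for each fixed `A > 0` and `ε > 0`, one has
`|∑_{i∈I} c_i ∑_m ψ_M(m) 1_{m=a_i (q)} − (M'/q) ∑_{i∈I} c_i| ≪ (log M)^{O(1)} (M/q) ∑_{0<|h|≤qM^{−1+ε}} |∑_{i∈I} c_i e_q(a_i h)| + M^{−A} ∑_{i∈I} |c_i|`",

where `M' := ∑_m ψ_M(m)` and `FT_q(f)(h) = q^{−1/2} ∑_x f(x) e_q(hx)`.  The paper keeps the constants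
implicit ("`≪ (log M)^{O(1)}`", coming from the hypothesis `|ψ^{(j)}| ≪ log^{O(1)} M`); as announced at
the start of its §4 ("we will not use the asymptotic convention … but provide explicit estimates")
everything here is stated with EXPLICIT constants in terms of the `L¹` norms `∫|ψ|` and `∫|ψ^{(n)}|`
of the fixed bump `ψ` (any smooth compactly supported `ψ : ℝ → ℂ`; no normalisation of the support
is needed), for a `q`-periodic `g : ℤ → ℂ` (the paper's `f` on `ℤ/qℤ`) and — at no extra cost, as in
the proof of Corollary 4.16 — along an arithmetic progression `m = b + dk` (take `d = 1`, `b = 0` for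
the printed statement; the modulus of the dual sum is then `Q = dq`).  With the twisted complete sums
`T(h) := ∑_{0 ≤ j < q} g(b + dj) e(h(b + dj)/(dq))` (`= q^{1/2} FT_q(f)(h)` for `d = 1`, `b = 0`) we PROVE:

* `Polymath8a.completion_expansion` — the exact dual expansion
  `∑_k ψ_M(b + dk) g(b + dk) = (M/(dq)) ∑_{h ∈ ℤ} e(−x₀h/(dq)) ψ̂(Mh/(dq)) T(h)` (Poisson summation along
  progressions, the tree's `MatomakiMerikoski2023_lemma34`; `ψ̂ = 𝓕ψ` is Mathlib's Fourier transform);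
* `Polymath8a.completion_identity` — the frequencies `h ≡ 0 (dq)` sum up EXACTLY to the printed main
  term `(M'/(dq)) ∑_j g(b + dj)`, `M' = ∑_m ψ_M(m)`, leaving `(M/(dq)) ∑_{h ≢ 0 (dq)} e(−x₀h/(dq)) ψ̂(Mh/(dq)) T(h)`;
* `Polymath8a.completion_sup` — **Lemma 4.9 (i)**: if `|T(h)| ≤ B` for all `h ≢ 0 (dq)` then
  `|∑_k ψ_M(b + dk) g(b + dk) − (M'/(dq)) ∑_j g(b + dj)| ≤ (2∫|ψ| + ∫|ψ''|) · B`;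
* `Polymath8a.completion_truncated` — **the variant (second display of (i))**: for `H ≥ 1`, `n ≥ 2`,
  `|… − (M'/(dq)) ∑_j g(b + dj)| ≤ (M/(dq)) (∫|ψ|) ∑_{0<|h|≤H, h ≢ 0 (dq)} |T(h)| + (∑_j |g(b + dj)|) · 2 (∫|ψ^{(n)}|) (dq/(2πM))^n (M/(dq)) H^{1−n}`
  (with `H = qM^{−1+ε}` and `n − 1 ≥ A/ε` the last term is the printed `M^{−A} ∑ |f|`);
* `Polymath8a.completion_classes` — **Lemma 4.9 (ii)** (`d = 1`): for residues `a_i` and weights `c_i`,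
  `|∑_i c_i ∑_m ψ_M(m) 1_{m ≡ a_i (q)} − (M'/q) ∑_i c_i| ≤ (M/q)(∫|ψ|) ∑_{0<|h|≤H, q ∤ h} |∑_i c_i e(a_i h/q)| + (∑_i |c_i|) · 2 (∫|ψ^{(n)}|) (q/(2πM))^n (M/q) H^{1−n}`;
* `Polymath8a.norm_weightSum_sub_le` — `|M' − M ∫ψ| ≤ 4 M (∫|ψ^{(n)}|) (2πM)^{−n}` (so that `M'` may be
  replaced by `M ψ̂(0) = M∫ψ` at negligible cost, as is done implicitly in the paper).

Everything is PROVED (theorems only; no definitions, no named facts), from the tree's Poisson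
summation along progressions and Fourier decay of bumps (`FriedlanderIwaniecPrimesPoisson.lean`,
`PoissonTwistedProgression.lean`).  The route differs inessentially from the printed proof (which
periodises `ψ_M` modulo `q` and uses Plancherel on `ℤ/qℤ`, then Poisson summation for the periodised
weight): we apply Poisson summation class by class first; the frequencies `h ∈ qℤ ∖ {0}` that this
produces are identified with the difference `M' − M∫ψ` and moved into the main term, which makes the
two routes agree identically.

## References

* D. H. J. Polymath, *New equidistribution estimates of Zhang type*, Algebra & Number Theory 8:9
  (2014) 2067–2199, arXiv:1402.0811: §4.4, Lemma 4.9 and its proof. [cite: Polymath8a2014, Lemma 4.9]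
* K. Matomäki, J. Merikoski, IMRN 2023 (arXiv:2112.11412), Lemma 3.4 (the Poisson summation formula
  along a progression with a periodic twist, the tree's `MatomakiMerikoski2023_lemma34`).
  [cite: MatomakiMerikoski2023, Lemma 3.4]
-/

noncomputable section

open Real MeasureTheory Filter Complex Finset
open scoped FourierTransform Topology ContDiff

namespace Literature.NumberTheory.Sieve

namespace Polymath8a

open Literature.NumberTheory.Sieve.FriedlanderIwaniecPrimes (norm_fourier_div_le fourier_comp_affine
  norm_fourier_le_integral_norm sum_tail_norm_fourier_div_le summable_fourier_div
  tsum_arithProg_eq_tsum_fourier)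
open Literature.NumberTheory.LFunctions.MatomakiMerikoski (MatomakiMerikoski2023_lemma34)
open Literature.NumberTheory.Sieve.RamanujanSum (fourierChar_intCast)

/-! ### Symmetric sums over `[-N, N]` -/

/-- `∑_{h=-N}^{N} F(h) = F(0) + ∑_{ν=1}^{N} (F(ν) + F(-ν))`. [folklore] -/
theorem sum_Icc_neg_eq {A : Type*} [AddCommMonoid A] (F : ℤ → A) (N : ℕ) :
    ∑ h ∈ Finset.Icc (-(N : ℤ)) N, F h = F 0 + ∑ ν ∈ Finset.Icc 1 N, (F ν + F (-(ν : ℤ))) := by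
  classical
  set negEmb : ℕ ↪ ℤ := ⟨fun ν : ℕ => -(ν : ℤ), fun a b h => by simpa using h⟩ with hnegEmb
  have hdecomp : Finset.Icc (-(N : ℤ)) N =
      ((Finset.Icc 1 N).map negEmb ∪ {0}) ∪ (Finset.Icc 1 N).map Nat.castEmbedding := by
    ext h
    simp only [Finset.mem_Icc, Finset.mem_union, Finset.mem_map, Finset.mem_singleton,
      Nat.castEmbedding_apply, hnegEmb, Function.Embedding.coeFn_mk]
    constructor
    · intro hh
      rcases lt_trichotomy h 0 with hlt | heq | hgt
      · left; left
        exact ⟨h.natAbs, ⟨by omega, by omega⟩, by omega⟩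
      · left; right; exact heq
      · right
        exact ⟨h.toNat, ⟨by omega, by omega⟩, by omega⟩
    · rintro ((⟨ν, hν, rfl⟩ | rfl) | ⟨ν, hν, rfl⟩) <;> omega
  have hd1 : Disjoint ((Finset.Icc 1 N).map negEmb) {0} := by
    rw [Finset.disjoint_singleton_right, Finset.mem_map]
    rintro ⟨ν, hν, h0⟩
    simp only [hnegEmb, Function.Embedding.coeFn_mk, neg_eq_zero, Nat.cast_eq_zero] at h0
    rw [Finset.mem_Icc] at hν; omega
  have hd2 : Disjoint ((Finset.Icc 1 N).map negEmb ∪ {0})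
      ((Finset.Icc 1 N).map Nat.castEmbedding) := by
    rw [Finset.disjoint_left]
    intro h hh
    simp only [Finset.mem_union, Finset.mem_map, Finset.mem_singleton, hnegEmb,
      Function.Embedding.coeFn_mk, Nat.castEmbedding_apply, Finset.mem_Icc] at hh ⊢
    rintro ⟨ν, hν, rfl⟩
    rcases hh with ⟨ν', hν', h'⟩ | h0
    · omega
    · omega
  rw [hdecomp, Finset.sum_union hd2, Finset.sum_union hd1, Finset.sum_singleton, Finset.sum_map,
    Finset.sum_map, Finset.sum_add_distrib]
  simp only [hnegEmb, Function.Embedding.coeFn_mk, Nat.castEmbedding_apply]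
  abel

/-- A finite set of integers lies in some `[-N, N]`. [folklore] -/
theorem exists_subset_Icc_neg (u : Finset ℤ) : ∃ N : ℕ, u ⊆ Finset.Icc (-(N : ℤ)) N := by
  refine ⟨u.sup Int.natAbs, fun k hk => ?_⟩
  have := Finset.le_sup (f := Int.natAbs) hk
  rw [Finset.mem_Icc]; omega

/-- `∑_{1 ≤ ν ≤ N} ν^{-n} ≤ 2` for `n ≥ 2`. [folklore] -/
theorem sum_Icc_inv_pow_le_two {n : ℕ} (hn : 2 ≤ n) (N : ℕ) :
    ∑ ν ∈ Finset.Icc 1 N, (((ν : ℝ)) ^ n)⁻¹ ≤ 2 := by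
  rcases Nat.eq_zero_or_pos N with hN0 | hNpos
  · subst hN0; simp
  have hI : Finset.Icc 1 N = Finset.Ioc 0 N := by simpa using Finset.Icc_add_one_left_eq_Ioc 0 N
  rw [hI, ← Finset.sum_Ioc_consecutive _ (Nat.zero_le 1) hNpos, Nat.Ioc_succ_singleton,
    Finset.sum_singleton]
  have h1 := FriedlanderIwaniecPrimes.sum_Ioc_inv_pow_le hn le_rfl N
  simp only [zero_add, Nat.cast_one, one_pow, inv_one] at h1 ⊢
  linarith

/-! ### The scaled weight `ψ_M(u) = ψ((u − x₀)/M)` and its Fourier transform -/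

section Weight

variable {ψ : ℝ → ℂ} {M : ℝ}

/-- `u ↦ ψ((u − x₀)/M)` is smooth if `ψ` is. [folklore] -/
theorem contDiff_scaledWeight (hψ : ContDiff ℝ ∞ ψ) (M x₀ : ℝ) :
    ContDiff ℝ ∞ (fun u : ℝ => ψ ((u - x₀) / M)) :=
  hψ.comp ((contDiff_id.sub contDiff_const).div_const M)

/-- `u ↦ ψ((u − x₀)/M)` has compact support if `ψ` has and `M ≠ 0`. [folklore] -/
theorem hasCompactSupport_scaledWeight (hψc : HasCompactSupport ψ) (hM : M ≠ 0) (x₀ : ℝ) :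
    HasCompactSupport (fun u : ℝ => ψ ((u - x₀) / M)) := by
  have h := hψc.comp_homeomorph
    ((Homeomorph.addRight (-x₀)).trans (Homeomorph.mulRight₀ M⁻¹ (inv_ne_zero hM)))
  have hfeq : (fun u : ℝ => ψ ((u - x₀) / M)) =
      ψ ∘ ⇑((Homeomorph.addRight (-x₀)).trans (Homeomorph.mulRight₀ M⁻¹ (inv_ne_zero hM))) := by
    funext u
    simp [div_eq_mul_inv, sub_eq_add_neg]
  rw [hfeq]
  exact h

/-- **Fourier transform of the scaled weight**: `𝓕(ψ((· − x₀)/M))(ξ) = M e(−x₀ξ) ψ̂(Mξ)` for `M > 0`.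
[folklore] -/
theorem fourier_scaledWeight (ψ : ℝ → ℂ) (hM : 0 < M) (x₀ ξ : ℝ) :
    𝓕 (fun u : ℝ => ψ ((u - x₀) / M)) ξ = (M : ℂ) * (𝐞 (-(x₀ * ξ)) : ℂ) * 𝓕 ψ (M * ξ) := by
  have hM0 : M ≠ 0 := hM.ne'
  have h := fourier_comp_affine ψ (d := M⁻¹) (inv_pos.mpr hM) (-x₀ / M) ξ
  have hfun : (fun u : ℝ => ψ (-x₀ / M + M⁻¹ * u)) = fun u : ℝ => ψ ((u - x₀) / M) := by
    funext u; congr 1; field_simp; ring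
  rw [hfun] at h
  rw [h]
  have h1 : ((M⁻¹ : ℝ) : ℂ)⁻¹ = (M : ℂ) := by push_cast; rw [inv_inv]
  have h2 : -x₀ / M * ξ / M⁻¹ = -(x₀ * ξ) := by field_simp
  have h3 : ξ / M⁻¹ = M * ξ := by rw [div_inv_eq_mul, mul_comm]
  rw [h1, h2, h3]

/-- `ψ̂(0) = ∫ ψ`. [folklore] -/
theorem fourier_apply_zero (ψ : ℝ → ℂ) : 𝓕 ψ 0 = ∫ t, ψ t := by
  rw [Real.fourier_real_eq]
  congr 1
  funext v
  simp

/-- **`M' = ∑_m ψ_M(m)` by Poisson summation**: `∑_{m ∈ ℤ} ψ((m − x₀)/M) = M ∑_{k ∈ ℤ} e(−x₀k) ψ̂(Mk)`.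
[folklore] -/
theorem weightSum_eq (hψ : ContDiff ℝ ∞ ψ) (hψc : HasCompactSupport ψ) (hM : 0 < M) (x₀ : ℝ) :
    ∑' m : ℤ, ψ ((m - x₀) / M) = (M : ℂ) * ∑' k : ℤ, (𝐞 (-(x₀ * k)) : ℂ) * 𝓕 ψ (M * k) := by
  have h := tsum_arithProg_eq_tsum_fourier (F := fun u : ℝ => ψ ((u - x₀) / M))
    (contDiff_scaledWeight hψ M x₀) (hasCompactSupport_scaledWeight hψc hM.ne' x₀) Nat.one_pos 0
  simp only [Int.cast_zero, Nat.cast_one, zero_add, one_mul, zero_mul,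
    AddChar.map_zero_eq_one, Circle.coe_one, inv_one, div_one] at h
  rw [h, ← tsum_mul_left]
  refine tsum_congr fun k => ?_
  rw [fourier_scaledWeight ψ hM x₀ k, mul_assoc]

/-- The size of `ψ̂(Mk)`, `k ≠ 0`: `|ψ̂(Mk)| ≤ (∫|ψ^{(n)}|) (2πM)^{−n} |k|^{−n}`. [folklore] -/
theorem norm_fourier_mul_le (hψ : ContDiff ℝ ∞ ψ) (hψc : HasCompactSupport ψ) (hM : 0 < M) (n : ℕ)
    {k : ℝ} (hk : 0 < |k|) :
    ‖𝓕 ψ (M * k)‖ ≤ (∫ t, ‖iteratedDeriv n ψ t‖) * (M⁻¹ / (2 * π)) ^ n * (|k| ^ n)⁻¹ := by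
  have h := norm_fourier_div_le hψ hψc n (d := M⁻¹) (inv_pos.mpr hM) hk
  rwa [div_inv_eq_mul, mul_comm k M] at h

/-- **`|M' − M∫ψ| ≤ 4M (∫|ψ^{(n)}|) (2πM)^{−n}`** for `n ≥ 2`: the sum `M' = ∑_m ψ((m − x₀)/M)` of the
weight may be replaced by `M ψ̂(0) = M ∫ψ` at negligible cost (repeated integration by parts).
[cite: Polymath8a2014, proof of Lemma 4.9] -/
theorem norm_weightSum_sub_le (hψ : ContDiff ℝ ∞ ψ) (hψc : HasCompactSupport ψ) (hM : 0 < M)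
    (x₀ : ℝ) {n : ℕ} (hn : 2 ≤ n) :
    ‖∑' m : ℤ, ψ ((m - x₀) / M) - (M : ℂ) * ∫ t, ψ t‖ ≤
      4 * M * (∫ t, ‖iteratedDeriv n ψ t‖) * (M⁻¹ / (2 * π)) ^ n := by
  have hM0 : M ≠ 0 := hM.ne'
  set Φ : ℤ → ℂ := fun k => (𝐞 (-(x₀ * k)) : ℂ) * 𝓕 ψ (M * k) with hΦ
  have hs0 := summable_fourier_div hψ hψc (d := M⁻¹) (inv_pos.mpr hM)
  have hs0' : Summable fun k : ℤ => 𝓕 ψ (M * k) := by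
    refine hs0.congr fun k => ?_
    rw [div_inv_eq_mul, mul_comm]
  have hΦs : Summable Φ := by
    refine Summable.of_norm_bounded hs0'.norm fun k => ?_
    rw [hΦ, norm_mul, Circle.norm_coe, one_mul]
  rw [weightSum_eq hψ hψc hM x₀, hΦs.tsum_eq_add_tsum_ite 0]
  have hΦ0 : Φ 0 = ∫ t, ψ t := by
    simp [hΦ, fourier_apply_zero]
  rw [hΦ0, mul_add, add_sub_cancel_left, norm_mul, Complex.norm_real, Real.norm_eq_abs,
    abs_of_pos hM]
  -- bound the remaining series by its partial sums
  set C : ℝ := (∫ t, ‖iteratedDeriv n ψ t‖) * (M⁻¹ / (2 * π)) ^ n with hC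
  have hC0 : 0 ≤ C := by positivity
  have hterm : ∀ k : ℤ, ‖(if k = 0 then 0 else Φ k)‖ ≤ if k = 0 then 0 else C * (|(k : ℝ)| ^ n)⁻¹ := by
    intro k
    split_ifs with hk
    · simp
    · rw [hΦ, norm_mul, Circle.norm_coe, one_mul]
      have hk' : 0 < |(k : ℝ)| := abs_pos.mpr (by exact_mod_cast hk)
      exact norm_fourier_mul_le hψ hψc hM n hk'
  have hsum_le : ∑' k : ℤ, ‖(if k = 0 then 0 else Φ k)‖ ≤ 4 * C := by
    refine Real.tsum_le_of_sum_le (fun k => norm_nonneg _) fun u => ?_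
    -- enlarge `u` to a symmetric interval `[-N, N]`
    obtain ⟨N, hsub⟩ := exists_subset_Icc_neg u
    refine (Finset.sum_le_sum_of_subset_of_nonneg hsub fun _ _ _ => norm_nonneg _).trans ?_
    refine (Finset.sum_le_sum fun k _ => hterm k).trans ?_
    rw [sum_Icc_neg_eq _ N, if_pos rfl, zero_add]
    have hpair : ∀ ν ∈ Finset.Icc 1 N,
        ((if ((ν : ℕ) : ℤ) = 0 then (0 : ℝ) else C * (|(((ν : ℕ) : ℤ) : ℝ)| ^ n)⁻¹) +
          (if (-((ν : ℕ) : ℤ)) = 0 then (0 : ℝ) else C * (|((-((ν : ℕ) : ℤ) : ℤ) : ℝ)| ^ n)⁻¹)) =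
        2 * C * (((ν : ℝ)) ^ n)⁻¹ := by
      intro ν hν
      rw [Finset.mem_Icc] at hν
      have hν0 : ((ν : ℕ) : ℤ) ≠ 0 := by omega
      rw [if_neg hν0, if_neg (neg_ne_zero.mpr hν0)]
      push_cast
      rw [abs_neg, Nat.abs_cast]
      ring
    rw [Finset.sum_congr rfl hpair, ← Finset.mul_sum]
    have htail := sum_Icc_inv_pow_le_two hn N
    nlinarith
  calc M * ‖∑' k : ℤ, if k = 0 then 0 else Φ k‖
      ≤ M * ∑' k : ℤ, ‖(if k = 0 then 0 else Φ k)‖ := by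
        refine mul_le_mul_of_nonneg_left (norm_tsum_le_tsum_norm ?_) hM.le
        refine Summable.of_norm_bounded (g := fun k => ‖Φ k‖) hΦs.norm fun k => ?_
        split_ifs <;> simp
    _ ≤ M * (4 * C) := mul_le_mul_of_nonneg_left hsum_le hM.le
    _ = _ := by rw [hC]; ring

end Weight

/-! ### The dual expansion and the main term (Lemma 4.9, proof) -/

section Completion

variable {ψ : ℝ → ℂ} {M : ℝ}

/-- The twisted complete sums are bounded by `∑_j |g(b + dj)|`. [folklore] -/
theorem norm_twistedSum_le (d q : ℕ) (b : ℤ) (g : ℤ → ℂ) (h : ℤ) :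
    ‖∑ j ∈ Finset.range q, g (b + d * j) * (𝐞 (((b + d * j : ℤ) : ℝ) * h / (d * q : ℕ)) : ℂ)‖ ≤
      ∑ j ∈ Finset.range q, ‖g (b + d * j)‖ := by
  refine (norm_sum_le _ _).trans (le_of_eq (Finset.sum_congr rfl fun j _ => ?_))
  rw [norm_mul, Circle.norm_coe, mul_one]

/-- The twisted complete sums only depend on `h` modulo `dq`. [folklore] -/
theorem twistedSum_add_mul (d q : ℕ) (b : ℤ) (g : ℤ → ℂ) (h n : ℤ) :
    ∑ j ∈ Finset.range q, g (b + d * j) * (𝐞 (((b + d * j : ℤ) : ℝ) * (h + (d * q : ℕ) * n) / (d * q : ℕ)) : ℂ) =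
      ∑ j ∈ Finset.range q, g (b + d * j) * (𝐞 (((b + d * j : ℤ) : ℝ) * h / (d * q : ℕ)) : ℂ) := by
  rcases Nat.eq_zero_or_pos (d * q) with hdq | hdq
  · simp [hdq]
  refine Finset.sum_congr rfl fun j _ => ?_
  congr 1
  obtain ⟨hd0, hq0⟩ : d ≠ 0 ∧ q ≠ 0 := by constructor <;> rintro rfl <;> simp at hdq
  have hd' : (d : ℝ) ≠ 0 := by exact_mod_cast hd0
  have hq' : (q : ℝ) ≠ 0 := by exact_mod_cast hq0
  have : ((b + d * j : ℤ) : ℝ) * (h + (d * q : ℕ) * n) / (d * q : ℕ) =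
      ((b + d * j : ℤ) : ℝ) * h / (d * q : ℕ) + (((b + d * j) * n : ℤ) : ℝ) := by
    push_cast
    field_simp
  rw [this, AddChar.map_add_eq_mul, Circle.coe_mul, fourierChar_intCast, mul_one]

/-- At the frequencies `h = (dq) k` the twisted complete sum is the plain sum `∑_j g(b + dj)`.
[folklore] -/
theorem twistedSum_mul (d q : ℕ) (b : ℤ) (g : ℤ → ℂ) (k : ℤ) :
    ∑ j ∈ Finset.range q, g (b + d * j) * (𝐞 (((b + d * j : ℤ) : ℝ) * (((d * q : ℕ) : ℤ) * k : ℤ) / (d * q : ℕ)) : ℂ) =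
      ∑ j ∈ Finset.range q, g (b + d * j) := by
  have h := twistedSum_add_mul d q b g 0 k
  simp only [Int.cast_zero, zero_add, mul_zero, zero_div, AddChar.map_zero_eq_one, Circle.coe_one,
    mul_one] at h
  rw [← h]
  refine Finset.sum_congr rfl fun j _ => ?_
  push_cast
  ring_nf

/-- **The dual expansion** (proof of Lemma 4.9, first display, in Poisson form): for a smooth compactly
supported `ψ`, `M > 0`, `x₀ ∈ ℝ`, `d, q ≥ 1`, `b ∈ ℤ` and a `q`-periodic `g : ℤ → ℂ`,
`∑_{k ∈ ℤ} ψ((b + dk − x₀)/M) g(b + dk) = (M/(dq)) ∑_{h ∈ ℤ} e(−x₀h/(dq)) ψ̂(Mh/(dq)) T(h)`,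
`T(h) = ∑_{0 ≤ j < q} g(b + dj) e(h(b + dj)/(dq))`. [cite: Polymath8a2014, proof of Lemma 4.9] -/
theorem completion_expansion (hψ : ContDiff ℝ ∞ ψ) (hψc : HasCompactSupport ψ) (hM : 0 < M)
    (x₀ : ℝ) {d q : ℕ} (hd : 0 < d) (hq : 0 < q) (b : ℤ) {g : ℤ → ℂ}
    (hg : ∀ m n : ℤ, g (m + q * n) = g m) :
    ∑' k : ℤ, ψ ((b + d * k - x₀) / M) * g (b + d * k) =
      (M : ℂ) / ((d * q : ℕ) : ℂ) * ∑' h : ℤ, (𝐞 (-(x₀ * h / (d * q : ℕ))) : ℂ) *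
        𝓕 ψ (M * h / (d * q : ℕ)) *
        ∑ j ∈ Finset.range q, g (b + d * j) * (𝐞 (((b + d * j : ℤ) : ℝ) * h / (d * q : ℕ)) : ℂ) := by
  have h34 := MatomakiMerikoski2023_lemma34 (f := fun u : ℝ => ψ ((u - x₀) / M))
    (contDiff_scaledWeight hψ M x₀) (hasCompactSupport_scaledWeight hψc hM.ne' x₀) hd hq b hg
  have hlhs : (fun k : ℤ => (fun u : ℝ => ψ ((u - x₀) / M)) ((b : ℝ) + (d : ℝ) * (k : ℝ)) * g (b + d * k)) =
      fun k : ℤ => ψ ((b + d * k - x₀) / M) * g (b + d * k) := rfl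
  rw [hlhs] at h34
  rw [h34, ← tsum_mul_left, ← tsum_mul_left]
  refine tsum_congr fun h => ?_
  rw [fourier_scaledWeight ψ hM x₀]
  have e1 : M * ((h : ℝ) / ((d * q : ℕ) : ℝ)) = M * h / (d * q : ℕ) := by ring
  have e2 : -(x₀ * ((h : ℝ) / ((d * q : ℕ) : ℝ))) = -(x₀ * h / (d * q : ℕ)) := by ring
  rw [e1, e2]
  ring

/-- Summability of the dual series. [folklore] -/
theorem summable_completionTerm (hψ : ContDiff ℝ ∞ ψ) (hψc : HasCompactSupport ψ) (hM : 0 < M)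
    (x₀ : ℝ) {d q : ℕ} (hdq : 0 < d * q) (b : ℤ) (g : ℤ → ℂ) :
    Summable fun h : ℤ => (𝐞 (-(x₀ * h / (d * q : ℕ))) : ℂ) * 𝓕 ψ (M * h / (d * q : ℕ)) *
      ∑ j ∈ Finset.range q, g (b + d * j) * (𝐞 (((b + d * j : ℤ) : ℝ) * h / (d * q : ℕ)) : ℂ) := by
  have hQ : (0 : ℝ) < (d * q : ℕ) := by exact_mod_cast hdq
  have hs := summable_fourier_div hψ hψc (d := (d * q : ℕ) / M) (div_pos hQ hM)
  refine Summable.of_norm_bounded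
    (g := fun h : ℤ => ‖𝓕 ψ ((h : ℝ) / (((d * q : ℕ) : ℝ) / M))‖ * ∑ j ∈ Finset.range q, ‖g (b + d * j)‖)
    (hs.norm.mul_right _) fun h => ?_
  rw [norm_mul, norm_mul, Circle.norm_coe, one_mul]
  have : M * (h : ℝ) / ((d * q : ℕ) : ℝ) = (h : ℝ) / (((d * q : ℕ) : ℝ) / M) := by
    field_simp
  rw [this]
  exact mul_le_mul_of_nonneg_left (norm_twistedSum_le d q b g h) (norm_nonneg _)

/-- **The main term** (Lemma 4.9, proof: "The contribution of the frequency `h = 0` is given by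
`(M'/q) ∑_{m ∈ ℤ/qℤ} f(m)`"): in the Poisson form the frequencies `h ∈ (dq)ℤ` add up exactly to
`(M'/(dq)) ∑_j g(b + dj)` with `M' = ∑_m ψ((m − x₀)/M)`, so that
`∑_k ψ((b + dk − x₀)/M) g(b + dk) = (M'/(dq)) ∑_j g(b + dj) + (M/(dq)) ∑_{h ≢ 0 (dq)} e(−x₀h/(dq)) ψ̂(Mh/(dq)) T(h)`.
[cite: Polymath8a2014, proof of Lemma 4.9] -/
theorem completion_identity (hψ : ContDiff ℝ ∞ ψ) (hψc : HasCompactSupport ψ) (hM : 0 < M)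
    (x₀ : ℝ) {d q : ℕ} (hd : 0 < d) (hq : 0 < q) (b : ℤ) {g : ℤ → ℂ}
    (hg : ∀ m n : ℤ, g (m + q * n) = g m) :
    ∑' k : ℤ, ψ ((b + d * k - x₀) / M) * g (b + d * k) =
      (∑' m : ℤ, ψ ((m - x₀) / M)) / ((d * q : ℕ) : ℂ) * ∑ j ∈ Finset.range q, g (b + d * j) +
      (M : ℂ) / ((d * q : ℕ) : ℂ) * ∑' h : ℤ, if ((d * q : ℕ) : ℤ) ∣ h then 0 else
        (𝐞 (-(x₀ * h / (d * q : ℕ))) : ℂ) * 𝓕 ψ (M * h / (d * q : ℕ)) *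
        ∑ j ∈ Finset.range q, g (b + d * j) * (𝐞 (((b + d * j : ℤ) : ℝ) * h / (d * q : ℕ)) : ℂ) := by
  have hdq : 0 < d * q := Nat.mul_pos hd hq
  have hQ : ((d * q : ℕ) : ℝ) ≠ 0 := by exact_mod_cast hdq.ne'
  have hQz : ((d * q : ℕ) : ℤ) ≠ 0 := by exact_mod_cast hdq.ne'
  set Φ : ℤ → ℂ := fun h => (𝐞 (-(x₀ * h / (d * q : ℕ))) : ℂ) * 𝓕 ψ (M * h / (d * q : ℕ)) *
    ∑ j ∈ Finset.range q, g (b + d * j) * (𝐞 (((b + d * j : ℤ) : ℝ) * h / (d * q : ℕ)) : ℂ) with hΦ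
  have hΦs : Summable Φ := summable_completionTerm hψ hψc hM x₀ hdq b g
  -- split the dual series into `h ∈ (dq)ℤ` and the rest
  set Φ₁ : ℤ → ℂ := fun h => if ((d * q : ℕ) : ℤ) ∣ h then Φ h else 0 with hΦ₁
  set Φ₂ : ℤ → ℂ := fun h => if ((d * q : ℕ) : ℤ) ∣ h then 0 else Φ h with hΦ₂
  have hΦ₁s : Summable Φ₁ := by
    refine Summable.of_norm_bounded hΦs.norm fun h => ?_
    simp only [hΦ₁]; split_ifs <;> simp
  have hΦ₂s : Summable Φ₂ := by
    refine Summable.of_norm_bounded hΦs.norm fun h => ?_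
    simp only [hΦ₂]; split_ifs <;> simp
  have hsplit : ∑' h : ℤ, Φ h = ∑' h : ℤ, Φ₁ h + ∑' h : ℤ, Φ₂ h := by
    rw [← hΦ₁s.tsum_add hΦ₂s]
    refine tsum_congr fun h => ?_
    simp only [hΦ₁, hΦ₂]; split_ifs <;> simp
  -- the multiples of `dq`: reindex `h = (dq) k`
  have hinj : Function.Injective fun k : ℤ => ((d * q : ℕ) : ℤ) * k :=
    fun k₁ k₂ hk => mul_left_cancel₀ hQz hk
  have hsupp : Function.support Φ₁ ⊆ Set.range fun k : ℤ => ((d * q : ℕ) : ℤ) * k := by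
    intro h hh
    rw [Function.mem_support] at hh
    by_cases hdvd : ((d * q : ℕ) : ℤ) ∣ h
    · obtain ⟨k, rfl⟩ := hdvd; exact ⟨k, rfl⟩
    · exfalso; apply hh; simp only [hΦ₁]; rw [if_neg hdvd]
  have h1 : ∑' h : ℤ, Φ₁ h = (∑ j ∈ Finset.range q, g (b + d * j)) *
      ∑' k : ℤ, (𝐞 (-(x₀ * k)) : ℂ) * 𝓕 ψ (M * k) := by
    rw [← hinj.tsum_eq hsupp, ← tsum_mul_left]
    refine tsum_congr fun k => ?_
    simp only [hΦ₁, hΦ, dvd_mul_right, if_true]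
    rw [twistedSum_mul d q b g k]
    have e1 : -(x₀ * ((((d * q : ℕ) : ℤ) * k : ℤ) : ℝ) / ((d * q : ℕ) : ℝ)) = -(x₀ * k) := by
      push_cast; field_simp
    have e2 : M * ((((d * q : ℕ) : ℤ) * k : ℤ) : ℝ) / ((d * q : ℕ) : ℝ) = M * k := by
      push_cast; field_simp
    rw [e1, e2]
    ring
  rw [completion_expansion hψ hψc hM x₀ hd hq b hg, hsplit, mul_add, h1, weightSum_eq hψ hψc hM x₀]
  congr 1
  ring

/-! ### Lemma 4.9 (i): the sup bound -/

/-- The non-zero frequencies carry at most `2∫|ψ| + ∫|ψ''|` of mass after the scaling: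
`(M/Q) ∑_{h ≠ 0} |ψ̂(Mh/Q)| ≤ 2∫|ψ| + ∫|ψ''|` for all `Q, M > 0` (split at `|h| ≈ Q/M`: the trivial bound
`|ψ̂| ≤ ∫|ψ|` below, two integrations by parts above; this is the estimate
"`∑_{0<|h|≤q/2} |Ψ(h/q)| ≪ (log M)^{O(1)} ∑_{1≤h≤q/2} M/(1+|h|M/q)² ≪ q (log M)^{O(1)}`" of the printed
proof). [cite: Polymath8a2014, proof of Lemma 4.9] -/
theorem scaled_tsum_norm_fourier_le (hψ : ContDiff ℝ ∞ ψ) (hψc : HasCompactSupport ψ) (hM : 0 < M)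
    {Q : ℝ} (hQ : 0 < Q) :
    M / Q * ∑' h : ℤ, (if h = 0 then 0 else ‖𝓕 ψ (M * h / Q)‖) ≤
      2 * (∫ t, ‖ψ t‖) + ∫ t, ‖iteratedDeriv 2 ψ t‖ := by
  set D : ℝ := Q / M with hD
  have hD0 : 0 < D := div_pos hQ hM
  set I0 : ℝ := ∫ t, ‖ψ t‖ with hI0
  set I2 : ℝ := ∫ t, ‖iteratedDeriv 2 ψ t‖ with hI2
  have hI0n : 0 ≤ I0 := integral_nonneg fun _ => norm_nonneg _
  have hI2n : 0 ≤ I2 := integral_nonneg fun _ => norm_nonneg _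
  have hπ2 : 4 ≤ π ^ 2 := by nlinarith [Real.two_le_pi]
  have harg : ∀ h : ℤ, M * h / Q = h / D := by intro h; rw [hD]; field_simp
  have hI : ∀ m : ℕ, Finset.Icc 1 m = Finset.Ioc 0 m := fun m => by
    simpa using Finset.Icc_add_one_left_eq_Ioc 0 m
  -- the finite symmetric sums
  have hfin : ∀ N : ℕ, ∑ ν ∈ Finset.Icc 1 N, (‖𝓕 ψ ((ν : ℝ) / D)‖ + ‖𝓕 ψ (-(ν : ℝ) / D)‖) ≤
      D * (2 * I0 + I2) := by
    intro N
    set K : ℕ := max 1 ⌊D⌋₊ with hK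
    have hK1 : 1 ≤ K := le_max_left _ _
    have h1K : (1 : ℝ) ≤ K := by exact_mod_cast hK1
    have hKinv : ((K : ℝ))⁻¹ ≤ 2 / D := by
      rw [inv_eq_one_div, div_le_div_iff₀ (by positivity) hD0, one_mul]
      rcases le_or_gt 1 D with hD1 | hD1
      · have hfl : (⌊D⌋₊ : ℝ) ≤ K := by exact_mod_cast le_max_right 1 ⌊D⌋₊
        have := Nat.lt_floor_add_one D
        linarith
      · linarith
    have hnn : ∀ ν : ℕ, 0 ≤ ‖𝓕 ψ ((ν : ℝ) / D)‖ + ‖𝓕 ψ (-(ν : ℝ) / D)‖ := fun ν => by positivity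
    -- enlarge to `N' = max N K` and split at `K`
    have hmono : ∑ ν ∈ Finset.Icc 1 N, (‖𝓕 ψ ((ν : ℝ) / D)‖ + ‖𝓕 ψ (-(ν : ℝ) / D)‖) ≤
        ∑ ν ∈ Finset.Ioc 0 K, (‖𝓕 ψ ((ν : ℝ) / D)‖ + ‖𝓕 ψ (-(ν : ℝ) / D)‖) +
        ∑ ν ∈ Finset.Ioc K (max N K), (‖𝓕 ψ ((ν : ℝ) / D)‖ + ‖𝓕 ψ (-(ν : ℝ) / D)‖) := by
      rw [Finset.sum_Ioc_consecutive _ (Nat.zero_le K) (le_max_right N K), hI]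
      exact Finset.sum_le_sum_of_subset_of_nonneg (Finset.Ioc_subset_Ioc_right (le_max_left _ _))
        fun ν _ _ => hnn ν
    -- small frequencies
    have hsmall : ∑ ν ∈ Finset.Ioc 0 K, (‖𝓕 ψ ((ν : ℝ) / D)‖ + ‖𝓕 ψ (-(ν : ℝ) / D)‖) ≤
        2 * D * I0 + I2 * D / (2 * π ^ 2) := by
      rcases le_or_gt 1 D with hD1 | hD1
      · have hKeq : K = ⌊D⌋₊ := max_eq_right ((Nat.one_le_floor_iff D).mpr hD1)
        have hKD : (K : ℝ) ≤ D := by rw [hKeq]; exact Nat.floor_le hD0.le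
        calc ∑ ν ∈ Finset.Ioc 0 K, (‖𝓕 ψ ((ν : ℝ) / D)‖ + ‖𝓕 ψ (-(ν : ℝ) / D)‖)
            ≤ ∑ ν ∈ Finset.Ioc 0 K, (I0 + I0) :=
              Finset.sum_le_sum fun ν _ => add_le_add (norm_fourier_le_integral_norm ψ _)
                (norm_fourier_le_integral_norm ψ _)
          _ = K * (2 * I0) := by
              rw [Finset.sum_const, Nat.card_Ioc, Nat.sub_zero, nsmul_eq_mul]; ring
          _ ≤ D * (2 * I0) := by gcongr
          _ ≤ 2 * D * I0 + I2 * D / (2 * π ^ 2) := by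
              have : 0 ≤ I2 * D / (2 * π ^ 2) := by positivity
              linarith
      · have hKeq : K = 1 := by
          rw [hK, Nat.floor_eq_zero.mpr hD1]; simp
        rw [hKeq, Nat.Ioc_succ_singleton, Finset.sum_singleton]
        have h1 := norm_fourier_div_le hψ hψc 2 hD0 (k := (1 : ℝ)) (by norm_num)
        have h2 := norm_fourier_div_le hψ hψc 2 hD0 (k := (-1 : ℝ)) (by norm_num)
        simp only [abs_one, abs_neg, one_pow, inv_one, mul_one] at h1 h2
        have e1 : (((0 + 1 : ℕ) : ℝ)) / D = 1 / D := by norm_num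
        have e2 : -(((0 + 1 : ℕ) : ℝ)) / D = -1 / D := by norm_num
        rw [e1, e2]
        have hDD : D ^ 2 ≤ D := by nlinarith
        have hsq : (D / (2 * π)) ^ 2 = D ^ 2 / (4 * π ^ 2) := by ring
        rw [hsq] at h1 h2
        have h3 : I2 * (D ^ 2 / (4 * π ^ 2)) ≤ I2 * (D / (4 * π ^ 2)) := by gcongr
        have h4 : I2 * (D / (4 * π ^ 2)) + I2 * (D / (4 * π ^ 2)) = I2 * D / (2 * π ^ 2) := by ring
        have h5 : 0 ≤ 2 * D * I0 := by positivity
        linarith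
    -- large frequencies
    have htail : ∑ ν ∈ Finset.Ioc K (max N K), (‖𝓕 ψ ((ν : ℝ) / D)‖ + ‖𝓕 ψ (-(ν : ℝ) / D)‖) ≤
        I2 * D / π ^ 2 := by
      have h := sum_tail_norm_fourier_div_le hψ hψc (le_refl 2) hD0 hK1 (max N K)
      have hK' : ((K : ℝ) ^ (2 - 1))⁻¹ ≤ 2 / D := by simpa using hKinv
      calc _ ≤ 2 * I2 * (D / (2 * π)) ^ 2 * ((K : ℝ) ^ (2 - 1))⁻¹ := h
        _ ≤ 2 * I2 * (D / (2 * π)) ^ 2 * (2 / D) := by gcongr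
        _ = I2 * D / π ^ 2 := by field_simp
    have h6 : I2 * D / (2 * π ^ 2) + I2 * D / π ^ 2 ≤ I2 * D := by
      rw [show I2 * D / (2 * π ^ 2) + I2 * D / π ^ 2 = I2 * D * (3 / (2 * π ^ 2)) by ring]
      have : 3 / (2 * π ^ 2) ≤ 1 := by rw [div_le_one (by positivity)]; linarith
      exact mul_le_of_le_one_right (by positivity) this
    linarith
  -- pass to the series
  have htsum : ∑' h : ℤ, (if h = 0 then 0 else ‖𝓕 ψ (M * h / Q)‖) ≤ D * (2 * I0 + I2) := by
    refine Real.tsum_le_of_sum_le (fun h => ?_) fun u => ?_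
    · simp only [Pi.zero_apply]; split_ifs <;> positivity
    obtain ⟨N, hsub⟩ := exists_subset_Icc_neg u
    refine (Finset.sum_le_sum_of_subset_of_nonneg hsub fun h _ _ => ?_).trans ?_
    · split_ifs <;> positivity
    rw [sum_Icc_neg_eq _ N, if_pos rfl, zero_add]
    refine le_trans (le_of_eq (Finset.sum_congr rfl fun ν hν => ?_)) (hfin N)
    rw [Finset.mem_Icc] at hν
    have hν0 : ((ν : ℕ) : ℤ) ≠ 0 := by omega
    rw [if_neg hν0, if_neg (neg_ne_zero.mpr hν0), harg, harg]
    push_cast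
    ring_nf
  calc M / Q * ∑' h : ℤ, (if h = 0 then 0 else ‖𝓕 ψ (M * h / Q)‖)
      = D⁻¹ * ∑' h : ℤ, (if h = 0 then 0 else ‖𝓕 ψ (M * h / Q)‖) := by rw [hD, inv_div]
    _ ≤ D⁻¹ * (D * (2 * I0 + I2)) := mul_le_mul_of_nonneg_left htsum (by positivity)
    _ = 2 * I0 + I2 := by field_simp

/-- **Polymath 8a, Lemma 4.9 (i)** (completion of sums, sup form): "If `f : ℤ/qℤ → ℂ` is a function,
then `|∑_m ψ_M(m) f(m) − (M'/q) ∑_{m ∈ ℤ/qℤ} f(m)| ≪ q^{1/2} (log M)^{O(1)} sup_{h ∈ ℤ/qℤ∖{0}} |FT_q(f)(h)|`",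
here with explicit constant and along a progression `b + dℤ` (modulus `Q = dq`; `d = 1`, `b = 0` is the
printed case, `q^{1/2} FT_q(f)(h)` being the twisted complete sum `T(h) = ∑_{j} f(j) e(hj/q)`): if
`|T(h)| ≤ B` for all `h ≢ 0 (dq)` (`B ≥ 0`), then
`|∑_k ψ((b + dk − x₀)/M) g(b + dk) − (M'/(dq)) ∑_{j<q} g(b + dj)| ≤ (2∫|ψ| + ∫|ψ''|) · B`,
`M' = ∑_m ψ((m − x₀)/M)`. [cite: Polymath8a2014, Lemma 4.9 (i), (4.13)] -/
theorem completion_sup (hψ : ContDiff ℝ ∞ ψ) (hψc : HasCompactSupport ψ) (hM : 0 < M)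
    (x₀ : ℝ) {d q : ℕ} (hd : 0 < d) (hq : 0 < q) (b : ℤ) {g : ℤ → ℂ}
    (hg : ∀ m n : ℤ, g (m + q * n) = g m) {B : ℝ} (hB0 : 0 ≤ B)
    (hB : ∀ h : ℤ, ¬ ((d * q : ℕ) : ℤ) ∣ h →
      ‖∑ j ∈ Finset.range q, g (b + d * j) * (𝐞 (((b + d * j : ℤ) : ℝ) * h / (d * q : ℕ)) : ℂ)‖ ≤ B) :
    ‖∑' k : ℤ, ψ ((b + d * k - x₀) / M) * g (b + d * k) -
        (∑' m : ℤ, ψ ((m - x₀) / M)) / ((d * q : ℕ) : ℂ) * ∑ j ∈ Finset.range q, g (b + d * j)‖ ≤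
      (2 * (∫ t, ‖ψ t‖) + ∫ t, ‖iteratedDeriv 2 ψ t‖) * B := by
  have hdq : 0 < d * q := Nat.mul_pos hd hq
  have hQ : (0 : ℝ) < (d * q : ℕ) := by exact_mod_cast hdq
  rw [completion_identity hψ hψc hM x₀ hd hq b hg, add_sub_cancel_left, norm_mul, norm_div,
    Complex.norm_real, Complex.norm_natCast, Real.norm_eq_abs, abs_of_pos hM]
  set F : ℤ → ℝ := fun h => if h = 0 then 0 else ‖𝓕 ψ (M * h / (d * q : ℕ))‖ with hF
  have hFs : Summable F := by
    have hs := (summable_fourier_div hψ hψc (d := (d * q : ℕ) / M) (div_pos hQ hM)).norm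
    refine Summable.of_nonneg_of_le (fun h => ?_) (fun h => ?_) hs
    · simp only [hF]; split_ifs <;> positivity
    · simp only [hF]
      split_ifs
      · positivity
      · rw [show M * (h : ℝ) / ((d * q : ℕ) : ℝ) = h / (((d * q : ℕ) : ℝ) / M) by field_simp]
  have hpt : ∀ h : ℤ, ‖(if ((d * q : ℕ) : ℤ) ∣ h then (0 : ℂ) else
      (𝐞 (-(x₀ * h / (d * q : ℕ))) : ℂ) * 𝓕 ψ (M * h / (d * q : ℕ)) *
        ∑ j ∈ Finset.range q, g (b + d * j) * (𝐞 (((b + d * j : ℤ) : ℝ) * h / (d * q : ℕ)) : ℂ))‖ ≤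
      F h * B := by
    intro h
    by_cases hdvd : ((d * q : ℕ) : ℤ) ∣ h
    · rw [if_pos hdvd, norm_zero]
      have : 0 ≤ F h := by simp only [hF]; split_ifs <;> positivity
      positivity
    · have hh0 : h ≠ 0 := by rintro rfl; exact hdvd (dvd_zero _)
      rw [if_neg hdvd, norm_mul, norm_mul, Circle.norm_coe, one_mul]
      simp only [hF, if_neg hh0]
      exact mul_le_mul_of_nonneg_left (hB h hdvd) (norm_nonneg _)
  have hsn : Summable fun h : ℤ => ‖(if ((d * q : ℕ) : ℤ) ∣ h then (0 : ℂ) else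
      (𝐞 (-(x₀ * h / (d * q : ℕ))) : ℂ) * 𝓕 ψ (M * h / (d * q : ℕ)) *
        ∑ j ∈ Finset.range q, g (b + d * j) * (𝐞 (((b + d * j : ℤ) : ℝ) * h / (d * q : ℕ)) : ℂ))‖ :=
    Summable.of_nonneg_of_le (fun _ => norm_nonneg _) hpt (hFs.mul_right B)
  calc M / ((d * q : ℕ) : ℝ) * ‖∑' h : ℤ, (if ((d * q : ℕ) : ℤ) ∣ h then (0 : ℂ) else
        (𝐞 (-(x₀ * h / (d * q : ℕ))) : ℂ) * 𝓕 ψ (M * h / (d * q : ℕ)) *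
          ∑ j ∈ Finset.range q, g (b + d * j) * (𝐞 (((b + d * j : ℤ) : ℝ) * h / (d * q : ℕ)) : ℂ))‖
      ≤ M / ((d * q : ℕ) : ℝ) * ∑' h : ℤ, F h * B := by
        refine mul_le_mul_of_nonneg_left ((norm_tsum_le_tsum_norm hsn).trans ?_) (by positivity)
        exact hsn.tsum_le_tsum hpt (hFs.mul_right B)
    _ = (M / ((d * q : ℕ) : ℝ) * ∑' h : ℤ, F h) * B := by rw [tsum_mul_right]; ring
    _ ≤ (2 * (∫ t, ‖ψ t‖) + ∫ t, ‖iteratedDeriv 2 ψ t‖) * B :=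
        mul_le_mul_of_nonneg_right (scaled_tsum_norm_fourier_le hψ hψc hM hQ) hB0

/-! ### Lemma 4.9 (i), second form: truncation of the dual sum -/

/-- **Polymath 8a, Lemma 4.9 (i), the variant (4.15)**: "`|∑_m ψ_M(m) f(m) − (M'/q) ∑_{m ∈ ℤ/qℤ} f(m)|
≪ (log M)^{O(1)} (M/q^{1/2}) ∑_{0<|h|≤ qM^{−1+ε}} |FT_q(f)(h)| + M^{−A} ∑_{m ∈ ℤ/qℤ} |f(m)|` for any fixed
`A > 0` and `ε > 0`", here with explicit constants, an arbitrary truncation point `H ≥ 1` and an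
arbitrary number `n ≥ 2` of integrations by parts, along a progression `b + dℤ` (modulus `Q = dq`):
`|∑_k ψ((b + dk − x₀)/M) g(b + dk) − (M'/Q) ∑_{j<q} g(b + dj)|`
`≤ (M/Q)(∫|ψ|) ∑_{|h| ≤ H, h ≢ 0 (Q)} |T(h)| + (∑_{j<q} |g(b + dj)|) · 2(∫|ψ^{(n)}|) (Q/(2πM))^n (M/Q) H^{1−n}`
(for `H = QM^{−1+ε}`, `(n − 1)ε ≥ A` the last term is `≪ M^{−A} ∑|f|`; `T(h) = ∑_j g(b + dj) e(h(b+dj)/Q)`,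
`M' = ∑_m ψ((m − x₀)/M)`). [cite: Polymath8a2014, Lemma 4.9 (i), (4.15)] -/
theorem completion_truncated (hψ : ContDiff ℝ ∞ ψ) (hψc : HasCompactSupport ψ) (hM : 0 < M)
    (x₀ : ℝ) {d q : ℕ} (hd : 0 < d) (hq : 0 < q) (b : ℤ) {g : ℤ → ℂ}
    (hg : ∀ m n : ℤ, g (m + q * n) = g m) {H : ℕ} (hH : 1 ≤ H) {n : ℕ} (hn : 2 ≤ n) :
    ‖∑' k : ℤ, ψ ((b + d * k - x₀) / M) * g (b + d * k) -
        (∑' m : ℤ, ψ ((m - x₀) / M)) / ((d * q : ℕ) : ℂ) * ∑ j ∈ Finset.range q, g (b + d * j)‖ ≤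
      M / (d * q : ℕ) * (∫ t, ‖ψ t‖) *
        ∑ h ∈ (Finset.Icc (-(H : ℤ)) H).filter (fun h => ¬ ((d * q : ℕ) : ℤ) ∣ h),
          ‖∑ j ∈ Finset.range q, g (b + d * j) * (𝐞 (((b + d * j : ℤ) : ℝ) * h / (d * q : ℕ)) : ℂ)‖ +
      (∑ j ∈ Finset.range q, ‖g (b + d * j)‖) * (2 * (∫ t, ‖iteratedDeriv n ψ t‖) *
        (((d * q : ℕ) : ℝ) / (2 * π * M)) ^ n * (M / (d * q : ℕ)) * ((H : ℝ) ^ (n - 1))⁻¹) := by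
  have hdq : 0 < d * q := Nat.mul_pos hd hq
  have hQ : (0 : ℝ) < (d * q : ℕ) := by exact_mod_cast hdq
  set Qr : ℝ := ((d * q : ℕ) : ℝ) with hQr
  set D : ℝ := Qr / M with hD
  have hD0 : 0 < D := div_pos hQ hM
  set I0 : ℝ := ∫ t, ‖ψ t‖ with hI0
  set In : ℝ := ∫ t, ‖iteratedDeriv n ψ t‖ with hIn
  have hI0n : 0 ≤ I0 := integral_nonneg fun _ => norm_nonneg _
  have hInn : 0 ≤ In := integral_nonneg fun _ => norm_nonneg _
  set G : ℝ := ∑ j ∈ Finset.range q, ‖g (b + d * j)‖ with hG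
  have hG0 : 0 ≤ G := Finset.sum_nonneg fun _ _ => norm_nonneg _
  set T : ℤ → ℂ := fun h => ∑ j ∈ Finset.range q, g (b + d * j) *
    (𝐞 (((b + d * j : ℤ) : ℝ) * h / (d * q : ℕ)) : ℂ) with hT
  have hTle : ∀ h, ‖T h‖ ≤ G := fun h => norm_twistedSum_le d q b g h
  set Φ₂ : ℤ → ℂ := fun h => if ((d * q : ℕ) : ℤ) ∣ h then 0 else
    (𝐞 (-(x₀ * h / (d * q : ℕ))) : ℂ) * 𝓕 ψ (M * h / (d * q : ℕ)) * T h with hΦ₂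
  rw [completion_identity hψ hψc hM x₀ hd hq b hg, add_sub_cancel_left, norm_mul, norm_div,
    Complex.norm_real, Complex.norm_natCast, Real.norm_eq_abs, abs_of_pos hM]
  change M / Qr * ‖∑' h : ℤ, Φ₂ h‖ ≤ M / Qr * I0 *
      ∑ h ∈ (Finset.Icc (-(H : ℤ)) H).filter (fun h => ¬ ((d * q : ℕ) : ℤ) ∣ h), ‖T h‖ +
    G * (2 * In * (Qr / (2 * π * M)) ^ n * (M / Qr) * ((H : ℝ) ^ (n - 1))⁻¹)
  have harg : ∀ h : ℤ, M * h / ((d * q : ℕ) : ℝ) = h / D := by intro h; rw [hD, hQr]; field_simp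
  -- pointwise bounds on `Φ₂`
  have hΦ₂le : ∀ h : ℤ, ‖Φ₂ h‖ ≤ (if ((d * q : ℕ) : ℤ) ∣ h then 0 else ‖𝓕 ψ ((h : ℝ) / D)‖ * ‖T h‖) := by
    intro h
    simp only [hΦ₂]
    split_ifs with hdvd
    · simp
    · rw [norm_mul, norm_mul, Circle.norm_coe, one_mul, harg]
  have hΦ₂le' : ∀ h : ℤ, ‖Φ₂ h‖ ≤ ‖𝓕 ψ ((h : ℝ) / D)‖ * G := by
    intro h
    refine (hΦ₂le h).trans ?_
    split_ifs
    · positivity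
    · exact mul_le_mul_of_nonneg_left (hTle h) (norm_nonneg _)
  have hΦ₂s : Summable fun h : ℤ => ‖Φ₂ h‖ :=
    Summable.of_nonneg_of_le (fun _ => norm_nonneg _) hΦ₂le'
      ((summable_fourier_div hψ hψc hD0).norm.mul_right G)
  -- the bound on partial sums
  set R : ℝ := I0 * ∑ h ∈ (Finset.Icc (-(H : ℤ)) H).filter (fun h => ¬ ((d * q : ℕ) : ℤ) ∣ h), ‖T h‖ +
    G * (2 * In * (D / (2 * π)) ^ n * ((H : ℝ) ^ (n - 1))⁻¹) with hR
  have hpartial : ∀ u : Finset ℤ, ∑ h ∈ u, ‖Φ₂ h‖ ≤ R := by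
    intro u
    obtain ⟨N₀, hsub₀⟩ := exists_subset_Icc_neg u
    set N : ℕ := max N₀ H with hN
    have hHN : H ≤ N := le_max_right _ _
    have hsub : u ⊆ Finset.Icc (-(N : ℤ)) N := hsub₀.trans (by
      intro h hh; rw [Finset.mem_Icc] at hh ⊢; constructor <;> omega)
    refine (Finset.sum_le_sum_of_subset_of_nonneg hsub fun _ _ _ => norm_nonneg _).trans ?_
    rw [← Finset.sum_filter_add_sum_filter_not (Finset.Icc (-(N : ℤ)) N) (fun h : ℤ => |h| ≤ H)]
    refine add_le_add ?_ ?_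
    · -- small frequencies: `|h| ≤ H`
      have hsub' : (Finset.Icc (-(N : ℤ)) N).filter (fun h : ℤ => |h| ≤ H) ⊆ Finset.Icc (-(H : ℤ)) H := by
        intro h hh
        rw [Finset.mem_filter, Finset.mem_Icc, abs_le] at hh
        rw [Finset.mem_Icc]; exact hh.2
      refine (Finset.sum_le_sum_of_subset_of_nonneg hsub' fun _ _ _ => norm_nonneg _).trans ?_
      refine (Finset.sum_le_sum fun h _ => hΦ₂le h).trans ?_
      rw [Finset.mul_sum, Finset.sum_filter]
      refine Finset.sum_le_sum fun h _ => ?_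
      by_cases hdvd : ((d * q : ℕ) : ℤ) ∣ h
      · rw [if_pos hdvd, if_neg (not_not.mpr hdvd)]
      · rw [if_neg hdvd, if_pos hdvd]
        exact mul_le_mul_of_nonneg_right (norm_fourier_le_integral_norm ψ _) (norm_nonneg _)
    · -- large frequencies: `|h| > H`
      refine (Finset.sum_le_sum fun h _ => hΦ₂le' h).trans ?_
      rw [Finset.sum_filter, sum_Icc_neg_eq _ N]
      have h0 : (if ¬ |(0 : ℤ)| ≤ (H : ℤ) then ‖𝓕 ψ (((0 : ℤ) : ℝ) / D)‖ * G else 0) = 0 := by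
        rw [if_neg]; push Not; simp
      rw [h0, zero_add]
      have hpair : ∀ ν ∈ Finset.Icc 1 N,
          ((if ¬ |((ν : ℕ) : ℤ)| ≤ (H : ℤ) then ‖𝓕 ψ ((((ν : ℕ) : ℤ) : ℝ) / D)‖ * G else 0) +
            (if ¬ |(-((ν : ℕ) : ℤ))| ≤ (H : ℤ) then ‖𝓕 ψ (((-((ν : ℕ) : ℤ) : ℤ) : ℝ) / D)‖ * G else 0)) =
          if ¬ ν ≤ H then (‖𝓕 ψ ((ν : ℝ) / D)‖ + ‖𝓕 ψ (-(ν : ℝ) / D)‖) * G else 0 := by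
        intro ν _
        have habs : |((ν : ℕ) : ℤ)| = ν := Nat.abs_cast ν
        rw [abs_neg, habs]
        by_cases hνH : ν ≤ H
        · have : ((ν : ℕ) : ℤ) ≤ (H : ℤ) := by exact_mod_cast hνH
          rw [if_neg (not_not.mpr this), if_neg (not_not.mpr this), if_neg (not_not.mpr hνH), add_zero]
        · have : ¬ ((ν : ℕ) : ℤ) ≤ (H : ℤ) := by exact_mod_cast hνH
          rw [if_pos this, if_pos this, if_pos hνH]
          push_cast
          ring
      rw [Finset.sum_congr rfl hpair, ← Finset.sum_filter]
      have hfilt : (Finset.Icc 1 N).filter (fun ν => ¬ ν ≤ H) = Finset.Ioc H N := by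
        ext ν
        simp only [Finset.mem_filter, Finset.mem_Icc, Finset.mem_Ioc, not_le]
        omega
      rw [hfilt, ← Finset.sum_mul]
      have htl := sum_tail_norm_fourier_div_le hψ hψc hn hD0 hH N
      calc (∑ ν ∈ Finset.Ioc H N, (‖𝓕 ψ ((ν : ℝ) / D)‖ + ‖𝓕 ψ (-(ν : ℝ) / D)‖)) * G
          ≤ (2 * In * (D / (2 * π)) ^ n * ((H : ℝ) ^ (n - 1))⁻¹) * G :=
            mul_le_mul_of_nonneg_right htl hG0
        _ = G * (2 * In * (D / (2 * π)) ^ n * ((H : ℝ) ^ (n - 1))⁻¹) := mul_comm _ _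
  -- assemble
  have hDn : D / (2 * π) = Qr / (2 * π * M) := by rw [hD, div_div, mul_comm M]
  have htsum : ∑' h : ℤ, ‖Φ₂ h‖ ≤ R := Real.tsum_le_of_sum_le (fun _ => norm_nonneg _) hpartial
  calc M / Qr * ‖∑' h : ℤ, Φ₂ h‖ ≤ M / Qr * R :=
        mul_le_mul_of_nonneg_left ((norm_tsum_le_tsum_norm hΦ₂s).trans htsum) (by positivity)
    _ = _ := by rw [hR, hDn]; ring

end Completion

/-! ### Lemma 4.9 (ii): sums over residue classes -/

section Classes

variable {ψ : ℝ → ℂ} {M : ℝ}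

open Literature.NumberTheory.LFunctions.MatomakiMerikoski (exists_eq_zero_of_hasCompactSupport)

/-- The weighted sums `∑_k ψ((k − x₀)/M) c(k)` are finite sums (compact support). [folklore] -/
theorem summable_scaledWeight_mul (hψc : HasCompactSupport ψ) (hM : M ≠ 0) (x₀ : ℝ) (c : ℤ → ℂ) :
    Summable fun k : ℤ => ψ ((k - x₀) / M) * c k := by
  obtain ⟨R, hR⟩ := exists_eq_zero_of_hasCompactSupport (hasCompactSupport_scaledWeight hψc hM x₀)
  refine summable_of_ne_finset_zero (s := Finset.Icc (-⌈R⌉) ⌈R⌉) fun k hk => ?_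
  have h2 : R < |(k : ℝ)| := by
    have hc := Int.le_ceil R
    rw [Finset.mem_Icc, not_and_or, not_le, not_le] at hk
    rcases hk with hk | hk
    · have hk' : (k : ℝ) < -(⌈R⌉ : ℝ) := by exact_mod_cast hk
      have := neg_abs_le (k : ℝ)
      linarith
    · have hk' : ((⌈R⌉ : ℤ) : ℝ) < k := by exact_mod_cast hk
      have := le_abs_self (k : ℝ)
      linarith
  have := hR _ h2
  beta_reduce at this
  rw [this, zero_mul]

/-- **The unique representative of a residue class in `[0, q)`**: for `q ≥ 1` and `a ∈ ℤ`, the only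
`j ∈ {0, …, q−1}` with `j ≡ a (mod q)` is `j = a mod q`, so
`∑_{0 ≤ j < q} 1_{j ≡ a (q)} F(j) = F(a mod q)`. [folklore] -/
theorem sum_range_ite_dvd_sub {β : Type*} [AddCommMonoid β] {q : ℕ} (hq : 0 < q) (a : ℤ) (F : ℕ → β) :
    ∑ j ∈ Finset.range q, (if (q : ℤ) ∣ (j : ℤ) - a then F j else 0) = F (a % (q : ℤ)).toNat := by
  have hq0 : (q : ℤ) ≠ 0 := by exact_mod_cast hq.ne'
  have hnn : 0 ≤ a % (q : ℤ) := Int.emod_nonneg _ hq0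
  have hlt : a % (q : ℤ) < q := Int.emod_lt_of_pos _ (by exact_mod_cast hq)
  have hcast : (((a % (q : ℤ)).toNat : ℕ) : ℤ) = a % (q : ℤ) := Int.toNat_of_nonneg hnn
  have hmem : (a % (q : ℤ)).toNat ∈ Finset.range q := by
    rw [Finset.mem_range]
    have : (((a % (q : ℤ)).toNat : ℕ) : ℤ) < q := by rw [hcast]; exact hlt
    exact_mod_cast this
  rw [Finset.sum_eq_single_of_mem _ hmem]
  · rw [if_pos]
    rw [hcast, ← Int.modEq_iff_dvd]
    exact (Int.mod_modEq a q).symm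
  · intro j hj hne
    rw [if_neg]
    intro hdvd
    apply hne
    have h1 : a % (q : ℤ) = (j : ℤ) % (q : ℤ) := Int.modEq_iff_dvd.mpr hdvd
    have h2 : (j : ℤ) % (q : ℤ) = j :=
      Int.emod_eq_of_lt (by positivity) (by exact_mod_cast Finset.mem_range.mp hj)
    have h3 : ((j : ℕ) : ℤ) = (((a % (q : ℤ)).toNat : ℕ) : ℤ) := by rw [hcast, h1, h2]
    exact_mod_cast h3

/-- **Polymath 8a, Lemma 4.9 (ii)** (completion of sums over residue classes): "If `I` is a finite
index set, and for each `i ∈ I`, `c_i` is a complex number and `a_i (q)` is a residue class, then for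
each fixed `A > 0` and `ε > 0`, one has
`|∑_{i∈I} c_i ∑_m ψ_M(m) 1_{m = a_i (q)} − (M'/q) ∑_{i∈I} c_i| ≪ (log M)^{O(1)} (M/q) ∑_{0<|h|≤qM^{−1+ε}} |∑_{i∈I} c_i e_q(a_i h)| + M^{−A} ∑_{i∈I} |c_i|`",
here with explicit constants, an arbitrary truncation `H ≥ 1` and `n ≥ 2` integrations by parts
(`M' = ∑_m ψ((m − x₀)/M)`; with `H = qM^{−1+ε}`, `(n−1)ε ≥ A` the last term is the printed one):
`|∑_i c_i ∑_{m ≡ a_i (q)} ψ((m − x₀)/M) − (M'/q) ∑_i c_i|`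
`≤ (M/q)(∫|ψ|) ∑_{|h| ≤ H, q ∤ h} |∑_i c_i e(a_i h/q)| + (∑_i |c_i|) · 2(∫|ψ^{(n)}|) (q/(2πM))^n (M/q) H^{1−n}`.
It is `completion_truncated` for `f(m) = ∑_{i : a_i ≡ m} c_i`, whose twisted complete sums are
`∑_i c_i e(a_i h/q)`. [cite: Polymath8a2014, Lemma 4.9 (ii), (4.16)] -/
theorem completion_classes (hψ : ContDiff ℝ ∞ ψ) (hψc : HasCompactSupport ψ) (hM : 0 < M)
    (x₀ : ℝ) {q : ℕ} (hq : 0 < q) {ι : Type*} (I : Finset ι) (c : ι → ℂ) (a : ι → ℤ)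
    {H : ℕ} (hH : 1 ≤ H) {n : ℕ} (hn : 2 ≤ n) :
    ‖∑ i ∈ I, c i * ∑' m : ℤ, (if (q : ℤ) ∣ m - a i then ψ ((m - x₀) / M) else 0) -
        (∑' m : ℤ, ψ ((m - x₀) / M)) / (q : ℂ) * ∑ i ∈ I, c i‖ ≤
      M / q * (∫ t, ‖ψ t‖) *
        ∑ h ∈ (Finset.Icc (-(H : ℤ)) H).filter (fun h => ¬ (q : ℤ) ∣ h),
          ‖∑ i ∈ I, c i * (𝐞 ((a i : ℝ) * h / q) : ℂ)‖ +
      (∑ i ∈ I, ‖c i‖) * (2 * (∫ t, ‖iteratedDeriv n ψ t‖) * ((q : ℝ) / (2 * π * M)) ^ n *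
        (M / q) * ((H : ℝ) ^ (n - 1))⁻¹) := by
  have hq0 : (q : ℤ) ≠ 0 := by exact_mod_cast hq.ne'
  have hq' : (q : ℝ) ≠ 0 := by exact_mod_cast hq.ne'
  set g : ℤ → ℂ := fun m => ∑ i ∈ I, if (q : ℤ) ∣ m - a i then c i else 0 with hg_def
  have hg : ∀ m k : ℤ, g (m + q * k) = g m := by
    intro m k
    simp only [hg_def]
    refine Finset.sum_congr rfl fun i _ => ?_
    rw [show m + q * k - a i = q * k + (m - a i) by ring]
    exact if_congr (dvd_add_right (dvd_mul_right _ _)) rfl rfl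
  have h := completion_truncated hψ hψc hM x₀ Nat.one_pos hq 0 hg hH hn
  simp only [hg_def, one_mul, zero_add, Nat.cast_one, Int.cast_zero, Int.cast_natCast] at h
  -- (1) the left-hand side
  have hL : ∑' k : ℤ, ψ ((k - x₀) / M) * (∑ i ∈ I, if (q : ℤ) ∣ k - a i then c i else 0) =
      ∑ i ∈ I, c i * ∑' m : ℤ, (if (q : ℤ) ∣ m - a i then ψ ((m - x₀) / M) else 0) := by
    have hs : ∀ i ∈ I, Summable fun k : ℤ =>
        ψ ((k - x₀) / M) * (if (q : ℤ) ∣ k - a i then c i else 0) :=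
      fun i _ => summable_scaledWeight_mul hψc hM.ne' x₀ _
    calc ∑' k : ℤ, ψ ((k - x₀) / M) * (∑ i ∈ I, if (q : ℤ) ∣ k - a i then c i else 0)
        = ∑' k : ℤ, ∑ i ∈ I, ψ ((k - x₀) / M) * (if (q : ℤ) ∣ k - a i then c i else 0) :=
          tsum_congr fun k => Finset.mul_sum _ _ _
      _ = ∑ i ∈ I, ∑' k : ℤ, ψ ((k - x₀) / M) * (if (q : ℤ) ∣ k - a i then c i else 0) :=
          Summable.tsum_finsetSum hs
      _ = _ := Finset.sum_congr rfl fun i _ => by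
          rw [← tsum_mul_left]
          refine tsum_congr fun k => ?_
          split_ifs <;> ring
  -- (2) the main term
  have h2 : ∑ x ∈ Finset.range q, ∑ i ∈ I, (if (q : ℤ) ∣ (x : ℤ) - a i then c i else 0) =
      ∑ i ∈ I, c i := by
    rw [Finset.sum_comm]
    exact Finset.sum_congr rfl fun i _ => sum_range_ite_dvd_sub hq (a i) (fun _ => c i)
  -- (3) the twisted complete sums
  have h3 : ∀ h' : ℤ, ∑ x ∈ Finset.range q, (∑ i ∈ I, if (q : ℤ) ∣ (x : ℤ) - a i then c i else 0) *
      ((𝐞 ((x : ℝ) * h' / q)) : ℂ) = ∑ i ∈ I, c i * (𝐞 ((a i : ℝ) * h' / q) : ℂ) := by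
    intro h'
    simp_rw [Finset.sum_mul]
    rw [Finset.sum_comm]
    refine Finset.sum_congr rfl fun i _ => ?_
    have hx : ∀ x : ℕ, (if (q : ℤ) ∣ (x : ℤ) - a i then c i else 0) * ((𝐞 ((x : ℝ) * h' / q)) : ℂ) =
        if (q : ℤ) ∣ (x : ℤ) - a i then c i * ((𝐞 ((x : ℝ) * h' / q)) : ℂ) else 0 := fun x => by
      split_ifs <;> simp
    simp_rw [hx]
    rw [sum_range_ite_dvd_sub hq (a i) (fun x : ℕ => c i * ((𝐞 ((x : ℝ) * h' / q)) : ℂ))]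
    congr 1
    set j₀ : ℕ := (a i % (q : ℤ)).toNat with hj₀
    have hj : ((j₀ : ℕ) : ℤ) = a i % q := Int.toNat_of_nonneg (Int.emod_nonneg _ hq0)
    obtain ⟨t, ht⟩ : (q : ℤ) ∣ (j₀ : ℤ) - a i := by
      rw [hj, ← Int.modEq_iff_dvd]; exact (Int.mod_modEq _ _).symm
    have ht' : ((j₀ : ℕ) : ℝ) = (a i : ℝ) + (q : ℝ) * t := by
      have h1 : ((j₀ : ℕ) : ℤ) = a i + q * t := by linarith
      have h2 := congrArg (fun z : ℤ => (z : ℝ)) h1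
      push_cast at h2
      exact h2
    have : ((j₀ : ℕ) : ℝ) * h' / q = (a i : ℝ) * h' / q + ((t * h' : ℤ) : ℝ) := by
      rw [ht']; push_cast; field_simp
    rw [this, AddChar.map_add_eq_mul, Circle.coe_mul, fourierChar_intCast, mul_one]
  -- (4) the `ℓ¹` mass
  have h4 : ∑ x ∈ Finset.range q, ‖∑ i ∈ I, (if (q : ℤ) ∣ (x : ℤ) - a i then c i else 0)‖ ≤
      ∑ i ∈ I, ‖c i‖ := by
    calc _ ≤ ∑ x ∈ Finset.range q, ∑ i ∈ I, ‖(if (q : ℤ) ∣ (x : ℤ) - a i then c i else 0)‖ :=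
          Finset.sum_le_sum fun x _ => norm_sum_le _ _
      _ = ∑ i ∈ I, ∑ x ∈ Finset.range q, (if (q : ℤ) ∣ (x : ℤ) - a i then ‖c i‖ else 0) := by
          rw [Finset.sum_comm]
          refine Finset.sum_congr rfl fun i _ => Finset.sum_congr rfl fun x _ => ?_
          split_ifs <;> simp
      _ = ∑ i ∈ I, ‖c i‖ :=
          Finset.sum_congr rfl fun i _ => sum_range_ite_dvd_sub hq (a i) (fun _ => ‖c i‖)
  rw [hL, h2] at h
  refine h.trans ?_
  have hC : 0 ≤ 2 * (∫ t, ‖iteratedDeriv n ψ t‖) * ((q : ℝ) / (2 * π * M)) ^ n *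
      (M / q) * ((H : ℝ) ^ (n - 1))⁻¹ := by
    have : 0 ≤ ∫ t, ‖iteratedDeriv n ψ t‖ := integral_nonneg fun _ => norm_nonneg _
    positivity
  refine add_le_add (le_of_eq ?_) (mul_le_mul_of_nonneg_right h4 hC)
  congr 1
  exact Finset.sum_congr rfl fun h' _ => by rw [h3 h']

end Classes

end Polymath8a

end Literature.NumberTheory.Sieve
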